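import Literature.Computability.Cryptography.RegevSamplerArith
import Literature.Algebra.EuclideanLattices.RegevDualQuery
import HarnessLib

/-!
# Regev 2009, Lemma 3.14 in machine form: the rescaled instance lattice

Topic `Computability/Cryptography` (family `pqc`), grouping namespace `Regev2009.SamplerScale`. The
register analysis of Regev's sampler in this tree (`Algebra/EuclideanLattices/RegevQuantumPart*.lean`,
`QPart.law_bound_of_basis`) is written in FIXED units: the Gaussian on the fine-lattice register is
`ρ₁`, the sampled law is `D_{L, 1/√2}` and the `CVP` promise radius on `L*` is `√n`. Regev's Lemma 3.14
(J. ACM 56 (2009), art. 34; author's version arXiv:2401.03703, p. 20: "given a lattice `L`, a number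
`d < λ₁(L*)/2` and an oracle for `CVP_{L*, d}`, output a sample from `D_{L, √n/(√2 d)}`") is obtained
from the fixed-units statement applied to the RESCALED lattice `L_t = t⁻¹ L(B)`, `t = √n/d` (so that
`L_t* = t L(B)*` has promise radius `t d = √n`, and `D_{L_t, 1/√2}` is the image of
`D_{L(B), t/√2} = D_{L(B), √n/(√2 d)}`). This file builds `L_t` for a nonsingular instance `B` and a
real `t ≠ 0` and proves the dictionary the instantiation uses:

* `homothety n t`, `scaledL I t = t⁻¹ L(B)` (Mathlib's `ZLattice.comap` of the homothety; discrete, a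
  full lattice), `mem_scaledL_iff` (`x ∈ L_t ↔ t x ∈ L(B)`), its `ℤ`-basis `scaledZBasis` (`= t⁻¹ bⱼ`);
* **`dualOverBasis_scaledL`** — the fine-lattice basis of `L_t*/R` built by `Regev2009.dualOverBasis`
  is `t • eB I R` (`t b∨ⱼ/R`), i.e. the fine lattice of the analysis is `t` times the fine lattice
  `L(B)*/R` of the sampler's integer arithmetic (`RegevSamplerArith.lean`), `dualOverBasis_scaledL_eq`;
* `floor_smul_eq`, **`fract_smul_eq`** — the branch scales: `fract_{t e}(t x) = t • fract_e(x)`;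
* **`map_val_discreteGaussian_scaledL`** — `D_{L_t, t⁻¹ r} = (t⁻¹ •)_* D_{L(B), r}` on the ambient
  space (from `discreteGaussian_map_val_eq_of_smul`).

Everything is proved; definitions have bodies; no named fact is introduced.

## References

* O. Regev, *On lattices, learning with errors, random linear codes, and cryptography*, J. ACM 56
  (2009), art. 34; author's version arXiv:2401.03703: Lemma 3.14 (p. 20), Lemma 3.3 (proof, p. 15)
  [Regev2009].
* D. Micciancio, O. Regev, *Worst-case to average-case reductions based on Gaussian measures*, SIAM J.
  Comput. 37 (2007), §2 (scaling of lattices and Gaussians) [MicciancioRegev2007].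
* D. Micciancio, S. Goldwasser, *Complexity of Lattice Problems*, Kluwer 2002, Ch. 1 §1.1 (the dual of
  a scaled lattice) [MicciancioGoldwasser2002].
-/

noncomputable section

namespace Literature.Computability.Cryptography

namespace Regev2009

namespace SamplerScale

open Literature.Algebra.EuclideanLattices Literature.Algebra.EuclideanLattices.Regev2009 Peikert2009 Matrix
  Finset SamplerArith Module
open scoped InnerProductSpace Pointwise

/-! ### The homothety and the rescaled lattice -/

/-- **The homothety `x ↦ t x`** of `ℝⁿ` (`t ≠ 0`) as a continuous linear automorphism. [folklore] -/
def homothety (n : ℕ) (t : ℝ) (ht : t ≠ 0) : EuclideanSpace ℝ (Fin n) ≃L[ℝ] EuclideanSpace ℝ (Fin n) :=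
  (LinearEquiv.smulOfNeZero (K := ℝ) (M := EuclideanSpace ℝ (Fin n)) t ht).toContinuousLinearEquiv

/-- `homothety n t x = t x`. [folklore] -/
@[simp] theorem homothety_apply {n : ℕ} {t : ℝ} (ht : t ≠ 0) (x : EuclideanSpace ℝ (Fin n)) :
    homothety n t ht x = t • x := rfl

/-- Its inverse is `x ↦ t⁻¹ x`. [folklore] -/
@[simp] theorem homothety_symm_apply {n : ℕ} {t : ℝ} (ht : t ≠ 0) (x : EuclideanSpace ℝ (Fin n)) :
    (homothety n t ht).symm x = t⁻¹ • x := by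
  rw [ContinuousLinearEquiv.symm_apply_eq, homothety_apply, smul_smul, mul_inv_cancel₀ ht, one_smul]

/-- The same for the underlying linear equivalence. [folklore] -/
theorem homothety_toLinearEquiv_symm_apply {n : ℕ} {t : ℝ} (ht : t ≠ 0) (x : EuclideanSpace ℝ (Fin n)) :
    (homothety n t ht).toLinearEquiv.symm x = t⁻¹ • x :=
  homothety_symm_apply ht x

variable (I : LatticeInstance) [hZ : IsZLattice ℝ I.lattice] (t : ℝ) (ht : t ≠ 0)

/-- **The rescaled lattice `L_t = t⁻¹ L(B)`** (the pullback of `L(B)` under `x ↦ t x`; discrete and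
full rank by Mathlib's `ZLattice.comap` instances). [cite: Regev2009, Lemma 3.14 (the parameter `√n/(√2 d)`)] [cite: MicciancioRegev2007, §2] -/
abbrev scaledL : Submodule ℤ (EuclideanSpace ℝ (Fin I.n)) :=
  ZLattice.comap ℝ I.lattice (homothety I.n t ht).toLinearMap

omit hZ in
/-- `x ∈ L_t ↔ t x ∈ L(B)`. [folklore] -/
theorem mem_scaledL_iff (x : EuclideanSpace ℝ (Fin I.n)) : x ∈ scaledL I t ht ↔ t • x ∈ I.lattice := Iff.rfl

omit hZ in
/-- `x ∈ L_t ↔ (t⁻¹)⁻¹ x ∈ L(B)` (the form `discreteGaussian_map_val_eq_of_smul` consumes). [folklore] -/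
theorem mem_scaledL_iff_inv_inv (x : EuclideanSpace ℝ (Fin I.n)) : x ∈ scaledL I t ht ↔ t⁻¹⁻¹ • x ∈ I.lattice := by
  rw [inv_inv]; exact mem_scaledL_iff I t ht x

omit hZ in
/-- `t⁻¹ y ∈ L_t` for `y ∈ L(B)`. [folklore] -/
theorem inv_smul_mem_scaledL {y : EuclideanSpace ℝ (Fin I.n)} (hy : y ∈ I.lattice) : t⁻¹ • y ∈ scaledL I t ht := by
  rw [mem_scaledL_iff, smul_smul, mul_inv_cancel₀ ht, one_smul]; exact hy

/-- **The `ℤ`-basis `t⁻¹ bⱼ` of `L_t`.** [folklore] -/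
def scaledZBasis : Basis (Fin I.n) ℤ (scaledL I t ht) :=
  (zBasis I).ofZLatticeComap ℝ I.lattice (homothety I.n t ht).toLinearEquiv

/-- `(t⁻¹ b)ⱼ = t⁻¹ bⱼ`. [folklore] -/
@[simp] theorem coe_scaledZBasis (j : Fin I.n) :
    ((scaledZBasis I t ht j : scaledL I t ht) : EuclideanSpace ℝ (Fin I.n)) = t⁻¹ • I.vec j := by
  rw [scaledZBasis, Basis.ofZLatticeComap_apply, homothety_toLinearEquiv_symm_apply, coe_zBasis]

/-- The real basis of `ℝⁿ` attached to `t⁻¹ b`. [folklore] -/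
theorem ofZLatticeBasis_scaledZBasis_apply (j : Fin I.n) :
    (scaledZBasis I t ht).ofZLatticeBasis ℝ (scaledL I t ht) j = t⁻¹ • I.vec j := by
  rw [Basis.ofZLatticeBasis_apply, coe_scaledZBasis]

/-! ### The fine lattice `L_t*/R` is `t • (L(B)*/R)` -/

/-- **The dual basis of `t⁻¹ b` is `t b∨`.** [cite: MicciancioGoldwasser2002, Ch. 1 §1.1] -/
theorem dualBasis_scaledZBasis :
    (LinearMap.BilinForm.dualBasis (innerₗ (EuclideanSpace ℝ (Fin I.n)) : LinearMap.BilinForm ℝ (EuclideanSpace ℝ (Fin I.n)))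
        innerₗ_nondegenerate ((scaledZBasis I t ht).ofZLatticeBasis ℝ (scaledL I t ht)) : Fin I.n → EuclideanSpace ℝ (Fin I.n)) =
      fun j => t • dualVec I j := by
  rw [LinearMap.BilinForm.dualBasis_eq_iff]
  intro i j
  rw [innerₗ_apply_apply, ofZLatticeBasis_scaledZBasis_apply, real_inner_smul_left, real_inner_smul_right, real_inner_comm,
    inner_vec_dualVec I j i, ← mul_assoc, mul_inv_cancel₀ ht, one_mul]

/-- **The fine-lattice basis of `L_t*/R` is `t • (b∨/R)`**: `dualOverBasis R L_t (t⁻¹ b) j = t • eB I R j`.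
[cite: Regev2009, Lemma 3.14 ("L*/R")] -/
theorem dualOverBasis_scaledL (R : ℕ) [NeZero R] (j : Fin I.n) :
    dualOverBasis R (scaledL I t ht) (scaledZBasis I t ht) j = t • eB I R j := by
  have h := congrFun (dualBasis_scaledZBasis I t ht) j
  simp only at h
  rw [dualOverBasis_apply, h, eB_apply, smul_smul, smul_smul, mul_comm]

/-- The same as an equality of bases: `dualOverBasis R L_t (t⁻¹ b) = (eB I R).unitsSMul t`. [folklore] -/
theorem dualOverBasis_scaledL_eq (R : ℕ) [NeZero R] :
    dualOverBasis R (scaledL I t ht) (scaledZBasis I t ht) = (eB I R).unitsSMul fun _ => Units.mk0 t ht :=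
  Basis.eq_of_apply_eq fun j => by rw [dualOverBasis_scaledL, Basis.unitsSMul_apply]; rfl

/-! ### The branch scales -/

section Fract

variable {ι V : Type*} [Fintype ι] [NormedAddCommGroup V] [NormedSpace ℝ V] (b : Basis ι ℝ V) {c : ℝ} (hc : c ≠ 0)

omit [Fintype ι] in
/-- Coordinates in the scaled basis: `repr_{c b}(c x) = repr_b(x)`. [folklore] -/
theorem repr_unitsSMul_smul (x : V) (i : ι) : (b.unitsSMul fun _ => Units.mk0 c hc).repr (c • x) i = b.repr x i := by
  simp only [Basis.repr_unitsSMul, Units.smul_def, smul_eq_mul, Units.val_inv_eq_inv_val, Units.val_mk0, map_smul,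
    Finsupp.smul_apply]
  rw [← mul_assoc, mul_inv_cancel₀ hc, one_mul]

/-- **`⌊c x⌋_{c b} = c ⌊x⌋_b`.** [folklore] -/
theorem floor_smul_eq (x : V) :
    (ZSpan.floor (b.unitsSMul fun _ => Units.mk0 c hc) (c • x) : V) = c • (ZSpan.floor b x : V) := by
  refine (b.unitsSMul fun _ => Units.mk0 c hc).ext_elem fun i => ?_
  rw [ZSpan.repr_floor_apply, repr_unitsSMul_smul]
  simp only [Basis.repr_unitsSMul, Units.smul_def, smul_eq_mul, Units.val_inv_eq_inv_val, Units.val_mk0, map_smul,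
    Finsupp.smul_apply, ZSpan.repr_floor_apply]
  rw [← mul_assoc, mul_inv_cancel₀ hc, one_mul]

/-- **The branch scales: `fract_{c b}(c x) = c • fract_b(x)`.** [cite: Regev2009, Lemma 3.14 (proof: "x mod P(L*)")] -/
theorem fract_smul_eq (x : V) :
    ZSpan.fract (b.unitsSMul fun _ => Units.mk0 c hc) (c • x) = c • ZSpan.fract b x := by
  rw [ZSpan.fract_apply, ZSpan.fract_apply, floor_smul_eq, smul_sub]

/-- The lattice part scales: `c x − fract_{c b}(c x) = c • (x − fract_b x)`. [folklore] -/
theorem sub_fract_smul_eq (x : V) :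
    c • x - ZSpan.fract (b.unitsSMul fun _ => Units.mk0 c hc) (c • x) = c • (x - ZSpan.fract b x) := by
  rw [fract_smul_eq, smul_sub]

end Fract


/-! ### `R · (L*/R) = L*` and the short-vector hypotheses of the law in rescaled units -/

section DualOver

variable {ι V : Type*} [Fintype ι] [DecidableEq ι] [NormedAddCommGroup V] [InnerProductSpace ℝ V] [FiniteDimensional ℝ V]
  (R : ℕ) [NeZero R] (L : Submodule ℤ V) [DiscreteTopology L] [IsZLattice ℝ L] (b : Basis ι ℤ L)

/-- Coordinates along `(L*ⱼ/R)` are `R` times the coordinates along `(L*ⱼ)`. [folklore] -/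
theorem repr_dualOverBasis (y : V) (i : ι) :
    (dualOverBasis (ι := ι) R L b).repr y i =
      (R : ℝ) * (LinearMap.BilinForm.dualBasis (innerₗ V : LinearMap.BilinForm ℝ V) innerₗ_nondegenerate
        (b.ofZLatticeBasis ℝ L)).repr y i := by
  rw [dualOverBasis, Basis.repr_unitsSMul, Units.smul_def, smul_eq_mul, Units.val_inv_eq_inv_val, Units.val_mk0, inv_inv]

/-- `y ∈ L*/R ↔ R y ∈ L*`. [cite: Regev2009, Lemma 3.14 ("L*/R")] -/
theorem mem_dualOver_iff_smul_mem_dualLattice (y : V) : y ∈ dualOver (ι := ι) R L b ↔ (R : ℝ) • y ∈ dualLattice L := by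
  rw [dualLattice_eq_span_dualBasis L b, Basis.mem_span_iff_repr_mem, Basis.mem_span_iff_repr_mem]
  simp_rw [repr_dualOverBasis, map_smul, Finsupp.smul_apply, smul_eq_mul]

/-- **`R · (L*/R) = L*`.** [cite: Regev2009, Lemma 3.14 ("L*/R")] -/
theorem scaledLattice_dualOver_eq_dualLattice : scaledLattice (dualOver (ι := ι) R L b) R = dualLattice L := by
  have hR : (R : ℝ) ≠ 0 := by exact_mod_cast NeZero.ne R
  ext z
  rw [mem_scaledLattice]
  constructor
  · rintro ⟨y, hy, rfl⟩
    exact (mem_dualOver_iff_smul_mem_dualLattice R L b y).1 hy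
  · intro hz
    refine ⟨(R : ℝ)⁻¹ • z, ?_, by rw [smul_smul, mul_inv_cancel₀ hR, one_smul]⟩
    rw [mem_dualOver_iff_smul_mem_dualLattice, smul_smul, mul_inv_cancel₀ hR, one_smul]
    exact hz

end DualOver

omit hZ in
/-- `L_t = t⁻¹ • L(B)` as a pointwise-scaled submodule. [folklore] -/
theorem scaledL_eq_smul : scaledL I t ht = t⁻¹ • I.lattice := by
  ext x
  rw [mem_scaledL_iff, Submodule.mem_smul_pointwise_iff_exists]
  constructor
  · intro hx
    exact ⟨t • x, hx, by rw [smul_smul, inv_mul_cancel₀ ht, one_smul]⟩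
  · rintro ⟨y, hy, rfl⟩
    rw [smul_smul, mul_inv_cancel₀ ht, one_smul]
    exact hy

omit hZ in
/-- **`L_t* = t • L(B)*`.** [cite: MicciancioGoldwasser2002, Ch. 1 §1.1] -/
theorem dualLattice_scaledL : dualLattice (scaledL I t ht) = t • dualLattice I.lattice := by
  rw [scaledL_eq_smul, dualLattice_pointwise_smul _ (inv_ne_zero ht), inv_inv]

omit hZ in
/-- `λ₁(L_t*) = |t| λ₁(L(B)*)`. [cite: MicciancioGoldwasser2002, Ch. 1 §1.1] -/
theorem minNorm_dualLattice_scaledL : minNorm (dualLattice (scaledL I t ht)) = |t| * minNorm (dualLattice I.lattice) := by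
  rw [dualLattice_scaledL, minNorm_pointwise_smul _ ht]

omit hZ in
/-- `λ₁(L_t) = |t|⁻¹ λ₁(L(B))`. [cite: MicciancioGoldwasser2002, Ch. 1 §1.1] -/
theorem minNorm_scaledL : minNorm (scaledL I t ht) = |t|⁻¹ * minNorm I.lattice := by
  rw [scaledL_eq_smul, minNorm_pointwise_smul _ (inv_ne_zero ht), abs_inv]

/-- **The hypothesis `λ₁(R Λ) ≥ 2√n` of the law in rescaled units** (`Λ = L_t*/R`, `R Λ = L_t* = t L(B)*`):
it holds as soon as `2√n ≤ t λ₁(L(B)*)`, i.e. — with `t = √n/d` — as soon as `2d ≤ λ₁(L(B)*)`, Regev's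
promise `d < λ₁(L*)/2`. [cite: Regev2009, Lemma 3.14 (hypothesis "d < λ₁(L*)/2")] -/
theorem eq_zero_of_mem_scaledLattice_dualOver_scaledL {t : ℝ} (ht : 0 < t) (R : ℕ) [NeZero R]
    (hd : 2 * Real.sqrt (finrank ℝ (EuclideanSpace ℝ (Fin I.n))) ≤ t * minNorm (dualLattice I.lattice)) :
    ∀ z ∈ scaledLattice (dualOver R (scaledL I t ht.ne') (scaledZBasis I t ht.ne')) R,
      ‖z‖ < 2 * Real.sqrt (finrank ℝ (EuclideanSpace ℝ (Fin I.n))) → z = 0 := by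
  intro z hz hzn
  rw [scaledLattice_dualOver_eq_dualLattice] at hz
  by_contra h0
  have h1 := minNorm_le_norm_of_mem_of_ne_zero _ hz h0
  rw [minNorm_dualLattice_scaledL, abs_of_pos ht] at h1
  linarith

omit hZ in
/-- **The hypothesis `λ₁(R L_t) ≥ 2√n` of the law in rescaled units**: it holds as soon as
`2√n · t ≤ R λ₁(L(B))` (Regev: `R ≥ 2^{3n} λₙ(L*)`; here `R = 2^κ` is a free precision parameter).
[cite: Regev2009, Lemma 3.14 (proof: "λ₁(RL) > √n")] -/
theorem eq_zero_of_mem_scaledL_of_norm_smul_lt {t : ℝ} (ht : 0 < t) (R : ℕ)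
    (hR : 2 * Real.sqrt (finrank ℝ (EuclideanSpace ℝ (Fin I.n))) * t ≤ R * minNorm I.lattice) :
    ∀ x ∈ scaledL I t ht.ne', ‖(R : ℝ) • x‖ < 2 * Real.sqrt (finrank ℝ (EuclideanSpace ℝ (Fin I.n))) → x = 0 := by
  intro x hx hxn
  by_contra h0
  have h1 := minNorm_le_norm_of_mem_of_ne_zero _ hx h0
  rw [minNorm_scaledL, abs_of_pos ht] at h1
  rw [norm_smul, Real.norm_natCast] at hxn
  have h2 : (R : ℝ) * (t⁻¹ * minNorm I.lattice) ≤ R * ‖x‖ := mul_le_mul_of_nonneg_left h1 (Nat.cast_nonneg R)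
  have h3 : (R : ℝ) * (t⁻¹ * minNorm I.lattice) = (R * minNorm I.lattice) / t := by
    rw [div_eq_mul_inv]; ring
  rw [h3, div_le_iff₀ ht] at h2
  nlinarith

/-! ### The discrete Gaussian on the rescaled lattice -/

omit hZ in
/-- **`D_{L_t, t⁻¹ r}` is the image of `D_{L(B), r}` under `y ↦ t⁻¹ y`** (`0 < t`).
[cite: MicciancioRegev2007, §2] [cite: Regev2009, Lemma 3.14 (the output width `√n/(√2 d)`)] -/
theorem map_val_discreteGaussian_scaledL {t : ℝ} (ht : 0 < t) {r : ℝ} (hr : 0 < r) :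
    (discreteGaussian (scaledL I t ht.ne') (t⁻¹ * r) 0).map Subtype.val =
      (discreteGaussian I.lattice r 0).map fun y : I.lattice => t⁻¹ • (y : EuclideanSpace ℝ (Fin I.n)) := by
  have h := discreteGaussian_map_val_eq_of_smul (L := I.lattice) (M := scaledL I t ht.ne') (inv_ne_zero ht.ne')
    (mem_scaledL_iff_inv_inv I t ht.ne') hr
  rwa [abs_of_pos (inv_pos.2 ht)] at h

end SamplerScale

end Regev2009

end Literature.Computability.Cryptography

end
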